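import Literature.MathematicalPhysics.QuantumFieldTheory.Balaban1983to89.B11Eq90V0primeBond
import Literature.MathematicalPhysics.QuantumFieldTheory.Balaban1983to89.B11Ineq189LocalLeaf

/-!
# `Balaban1983to89.B11Eq90V0primeSecondDerivative` — T. Bałaban, *The variational problem and background fields in renormalization group method for lattice gauge theories*, Commun. Math. Phys. **102** (1985) 277–309 [Balaban1985Variational]: p. 291's sentence «a bound similar to the bound (40) … but with the power of |A| lower by 1» APPLIED ONCE MORE — the mixed SECOND derivative of the genuine `V′₀(A, ∂p)` of (39) from the (40) majorant on a two-parameter complex plane («power of |A| lower by 2»), i.e. the local leaf `∂²V′₀` (U2(ii)) of the author-omitted second differentiation behind (189), p. 308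

statement-level skeleton of published theorems with citation tags; proofs where landed; nothing here is a claim about the Yang–Mills mass gap

PDF held: `paper:balaban1985-cmp102-variational-background` (journal page = PDF page + 276); pp. 284, 287, 291, 308 read by this seat from
the `lit read` text layer; displays as transcribed (render-read) in `B11Eq37NormBound` ((39)–(40)), `B11Eq63FunctionalDerivative` ((63)),
`B11Eq85FirstDerivative` ((90)), `B11Eq185SecondDerivative` ((185)), `B11Ineq189` ((189)).

CITATION HEADER (lean-in-tree rule 2026-08-18).  WHAT IS REPRODUCED: SKELETON row **B11.Eq189** ((189) p. 308, cell GAPS G-B11-G2 — the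
second differentiation of `V(A′)` is OMITTED IN PRINT, p. 308 verbatim: *«Now we have to differentiate those expressions second time. We do
not perform these calculations here, we have obtained all necessary results to do the calculations and estimates, let us formulate a final
result only»*), leaf **U2(ii)** of the cell census (`SECOND-DERIVATIVE-189.md` §4): *«V₀′(A, ∂p) (4 bond variables of one plaquette): Cauchy
in (s, t) with radii |A|∕(2|u|), |A|∕(2|v|) applied to the bound (40) on the doubled polydisc: |∂_u∂_v V₀′| ≤ O(1)(|A|ηC₁B₃ε₁(Lʲη)⁻² +
|A|²)|u||v| — «the power of |A| lower by» 2, the printed mechanism of p. 291 applied once more»*; it is the kernel of the census's term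
T4.1″ `Ξ[𝔄] = Σ_{p∈st(b)} ∂²V₀′(A″, ∂p)[e_b-slot, (U′𝔄)|_{∂p}]` (tree: the binder `hLeaf` of `B11Ineq189Census.termT41` ∕ `termT43`).

THE PRINT, verbatim.  p. 284 (40), first member (certified at complex configurations in `B11Eq36Complex.ineq40_first_complex`):
*«|V′₀(A, ∂p)| ≦ (|A|(∂p))³ηC₁B₃ε₁(Lʲη)⁻² + (2∕4!)(|A|(∂p))⁴»*.  p. 287 (63): *«The functional derivative is a kernel of the linear operator
acting on functions δA′ and defined as ⟨(δ∕δA′)D(A′), δA′⟩ = (d∕dτ)D(A′ + τδA′)|_{τ=0}.»*  p. 291 (under (90)): *«The derivative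
((∂∕∂A(b))V′₀)(A, ∂p) satisfies a bound similar to the bound (40) for the function V′₀(A, ∂p), but with the power of |A| lower by 1, and
with a different absolute constant. This implies that the functional derivative (90) can be estimated by O(1)ε₃²(ε₁ + ε₃)(Lʲη)⁻³ on Ω_j.»*
p. 308 (185): *«((δ²∕δA′²)V)(A′)𝔄 = (d∕dτ)((δ∕δA′)V)(A′ + τ𝔄)|_{τ=0} = (1∕2πi)∮_{|τ|=r} (dτ∕τ²)((δ∕δA′)V)(A′ + τ𝔄) (185)»* and (189):
*«|((δ∕δA′)𝔚)(A′, 𝔄; y, y′)| ≦ O(1)ε₃e^{−¼δ₀d(y,y′)}N_{y′}(𝔄) for A′ satisfying (77)»*.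

THE MECHANISM (print: the first-derivative sentence of p. 291 and the one-variable Cauchy formula (185); this file iterates both).
`V′₀(·, ∂p)` is ENTIRE (p. 282; `B11Eq90V0primeBond.contDiff_V0primeP`), so `g(z, w) = V′₀(A + zδ₁ + wδ₂, ∂p)` is entire in two complex
variables; along the plane `|A + zδ₁ + wδ₂|(∂p) ≦ s + |z|Δ₁ + |w|Δ₂`, so on the closed bidisc `|z| ≦ s∕(2Δ₁)`, `|w| ≦ s∕(2Δ₂)` the size is
`≦ 2s` and (40) (MONOTONE in the size) bounds `|g| ≦ (2s)³ηκ + (2∕4!)(2s)⁴`; CAUCHY'S INEQUALITY IN TWO VARIABLES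
(`B11Ineq189LocalLeaf.norm_fderiv_fderiv_apply_le_of_bound`: `‖∂_u∂_v f‖ ≦ M∕(rr′)`) gives
`|∂_z∂_w g(0, 0)| ≦ 4Δ₁Δ₂s⁻²·((2s)³ηκ + (4∕3)s⁴) = Δ₁Δ₂(32·s·ηκ + (16∕3)s²)` — THE (40) BOUND WITH THE POWER OF `|A|` LOWER BY TWO and
the absolute constants `(1, 2∕4!) ↦ (32, 16∕3)` (first derivative of record: `Δ(8s²ηκ + (4∕3)s³)`, `B11Eq36Complex.norm_deriv_V0prime_line_le`).
`∂_z∂_w g(0,0)` IS the second Fréchet derivative `D²V′₀(A, ∂p)[δ₁, δ₂]` ((63) iterated, `deriv_deriv_line_eq_fderiv₂`).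

WHAT IS CERTIFIED (kernel, sorry-free; axioms `propext` ∕ `Classical.choice` ∕ `Quot.sound`).  Carrier: [5]'s abstract finite lattice of
`B9Eq39Adjoint` ∕ `B11Eq26ActionExpansion` (sites `S`, directions `ι`, bijective shifts `T`, background units `U`, complete normed
`ℂ`-`*`-algebra `𝔸`, continuous tracial `*`-trace `τ`), the genuine `V′₀(A, ∂p) = B11Eq90V0primeBond.V0primeP` of (39).
§1 (generic, any complex normed space `E`, complete `F`) `deriv_deriv_line_eq_fderiv₂` ∕ `deriv_deriv_line_eq_fderiv_fderiv` ((63)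
   iterated: `∂_z∂_w Φ(X + zu + wv)|₀ = ∂_u∂_v Φ(X) = D²Φ(X) u v` for an entire `Φ`); `plane_le_two` (the size along the bidisc);
   **`norm_d2_le_of_majorant40`** — AN ENTIRE `Φ` MAJORISED BY THE FIRST MEMBER OF (40) ALONG THE BIDISC (`‖Φ(X + zu + wv)‖ ≦
   (x + |z|Δ_u + |w|Δ_v)³ηκ + (2∕4!)(x + |z|Δ_u + |w|Δ_v)⁴` for `|z| ≦ x∕(2Δ_u)`, `|w| ≦ x∕(2Δ_v)`) HAS `‖∂_u∂_v Φ(X)‖ ≦ Δ_uΔ_v(32xηκ + (16∕3)x²)`;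
   `norm_fderiv_fderiv_le_of_majorant40` (the same for `D²Φ(X) u v`).
§2 `size_lettersA_add_smul_add_smul_le` (`|A + zδ₁ + wδ₂|(∂p) ≦ |A|(∂p) + |z||δ₁|(∂p) + |w||δ₂|(∂p)`), `differentiable_V0primeP`;
   **`norm_d2_V0primeP_le` — p. 291's SENTENCE ITERATED, FOR THE GENUINE `V′₀(A, ∂p)` AT COMPLEX `A`**: for `|A|(∂p) ≦ s`, `|δᵢ|(∂p) ≦ Δᵢ`,
   `0 < s, Δ₁, Δ₂`, `e^{2ηs} ≦ 2`, under EXACTLY the (38)∕(31) trace-slot hypotheses of `B11Eq36Complex.ineq40_first_complex` (unitary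
   background, tracial `*`-trace, `hRe1`∕`hIm`∕`hW`∕`hW'` with constant `κ`): `‖∂_{δ₁}∂_{δ₂}V′₀(A, ∂p)‖ ≦ Δ₁Δ₂(32·s·ηκ + (16∕3)s²)`;
   `norm_deriv_deriv_V0primeP_line_le` (the same for the iterated line derivative `(∂²∕∂z∂w)V′₀(A + zδ₁ + wδ₂, ∂p)|₀`);
   `norm_fderiv_fderiv_V0primeP_le` (for `D²V′₀(A, ∂p) δ₁ δ₂`).
§3 THE TWO-BOND KERNEL ENTRIES `(∂²∕∂A(b₁)∂A(b₂))V′₀(A, ∂q)[X, Y] = ∂_{δ_{b₁}X}∂_{δ_{b₂}Y}V′₀(A, ∂q)` of the census's `Ξ`: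
   `fderiv_V0primeP_bondDelta_eq_zero`, **`d2_V0primeP_bond_eq_zero_left` ∕ `_right`** — LOCALITY: the entry VANISHES unless `q ∈ st(b₁)`
   AND `q ∈ st(b₂)` («Σ_{p∈st(b)}» of (90): a plaquette sees only its four boundary bonds, `B11Eq90StB.lettersA_bondDelta_of_not_mem_st`);
   **`norm_d2_V0primeP_bond_le`** — `‖∂_{δ_{b₁}X}∂_{δ_{b₂}Y}V′₀(A, ∂q)‖ ≦ 16(32·s·ηκ + (16∕3)s²)‖X‖‖Y‖` (`|δ_b X|(∂q) ≦ 4‖X‖`,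
   `B11Eq90V0primeBond.size_lettersA_bondDelta_le`, background in the unit balls).
§4 THE (189) JUNCTION SCALARS (companions of `B11Eq90V0Derivative.hg90_of_deriv40` ∕ `B11Eq85FirstDerivative.ineq90`):
   **`hβ189_of_d2_40`** — `g ≦ Δ(32sη·K∕t² + (16∕3)s²)` with `|A|(∂p) ≦ s ≦ 4x` (`x` the sup majorant of `|A|`), `κ = K(Lʲη)⁻²`, `η ≦ Lʲη = t`
   gives `g ≦ 128Δ·x(K + tx)∕t` (first derivative of record: `128Δ·x²(K + tx)∕t` — one power of `x` fewer); **`ineq189_T41_of_d2_40`** — with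
   `K = C₁B₃ε₁` ((38)) and `Lʲη·x ≦ 2ε₃` ((57)): `g ≦ 512Δ·max{C₁B₃, 1}·ε₃(ε₁ + ε₃)(Lʲη)⁻²` — the census's «β = O(1)ε₃(ε₁ + ε₃)» for T4.1″.
§5 **`ineq189_leafT41_V0prime` — END TO END for the genuine two-bond entries**: `‖∂_{δ_{b₁}X}∂_{δ_{b₂}Y}V′₀(A, ∂q)‖ ≦
   512·(16‖X‖‖Y‖)·max{C₁B₃, 1}·ε₃(ε₁ + ε₃)(Lʲη)⁻²` from print's data ((38) trace slots with `κ = C₁B₃ε₁(Lʲη)⁻²`, (57), `e^{2ηs} ≦ 2`).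

HONEST SCOPE — what is NOT claimed.  (i) Hypotheses are print's and are EXACTLY those of `B11Eq36Complex.norm_deriv_V0prime_line_le` ∕
`B11Eq90V0primeBond.opNorm_dV0primeBond_le` (unitary background `U(b)⁻¹ = U(b)*`, tracial `*`-trace, the (38)∕(31) trace slots, the unit-ball
bounds `‖U(b)‖, ‖U(b)⁻¹‖ ≦ 1` for `|δ_b X|(∂p) ≦ 4‖X‖`); nothing of (14)∕(38) is derived.  (ii) `V′₀` ONLY (census group T4): the sum over
`p ∈ st(b)` (`#st(b) ≦ 2(d − 1)`, `B11Eq90StB`), the composition with the Sect. C map `A″ = A′ − HD(A′)` and the dressing `U′ = I − H𝔇` in the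
𝔄-slot, the operator `𝔇*(A′)H*` of (90)'s second line, and the conversion of `Δ₁Δ₂`, `(Lʲη)`-weights into the census's N-units ∕ (−3)-units are
the CENSUS's (`B11Ineq189Census.termT41` ∕ `termT43`: letters `hU`, `b₁.κ`, `c`); on the one-site normed carrier of
`B11Ineq189CensusNorm` the norm bound of §3 IS the binder `hLeaf` by `hasMaj_norm_iff` (one line at the consumer; not imported here).
(iii) The other local leaves of the census are elsewhere: U2(i) `C_k` (`B11Ineq189LeafCk*`), the Sect. C map `D` (`B11Ineq189LeafD`), U2(iii)
the cubic polynomials (`B11Ineq189LocalLeaf` §5); the located intermediate δ𝔇 (U1) is `B11Ineq189.d2D_shape` ∕ `B11Ineq189Census`.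
(iv) [5]'s abstract carrier and sizes (DIVERGENCE D-pv27.4 inherited); the constants `32`, `16∕3`, `16`, `128`, `512` are explicit witnesses
of print's «different absolute constant» ∕ «O(1)» from the radii `s∕(2Δ₁)`, `s∕(2Δ₂)` (not optimal).  (v) Nothing of Propositions 3–9,
Theorem 1, (B) UV stability or any summit statement is asserted; NOT summit progress.  No `def`, no new named fact; theorem-only module.
Unit `pub-ymgap-dag-n07-b-g0` (cell `pub-ymgap`, YM-DAG node N07 = [B11], -b₁ FIRST-MISSING-ESTIMATE seat; tenth file of the seat's (189)
leaf line after `B11Prop9Model`, `B11Ineq189LocalLeaf`, `B11Ineq189LeafCk`, `B11Ineq189LeafD`, `B11Ineq189LeafCkLocal`,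
`B11Ineq189HasMaj2Kernel`, `B11Ineq189LeafCkHasMaj2`, `B11Ineq189LeafDModel`).  Imports `B11Eq90V0primeBond` (NE9 lineage, gen 64) and
`B11Ineq189LocalLeaf` ONLY; modifies nothing there.
-/

noncomputable section

open NormedSpace Complex Metric Set

namespace Literature.MathematicalPhysics.QuantumFieldTheory.Balaban1983to89.B11Eq90V0primeSecondDerivative

open Literature.MathematicalPhysics.QuantumFieldTheory.Balaban1983to89
open Literature.MathematicalPhysics.QuantumFieldTheory.Balaban1983to89.Beta.TransportVertices
open Literature.MathematicalPhysics.QuantumFieldTheory.Balaban1983to89.Beta.AdjointTransportJets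
open Literature.MathematicalPhysics.QuantumFieldTheory.Balaban1983to89.B9Eq37Insertion
open Literature.MathematicalPhysics.QuantumFieldTheory.Balaban1983to89.B9Eq39Adjoint
open Literature.MathematicalPhysics.QuantumFieldTheory.Balaban1983to89.B11Eq26ActionExpansion
open Literature.MathematicalPhysics.QuantumFieldTheory.Balaban1983to89.B11Eq90V0Derivative
open Literature.MathematicalPhysics.QuantumFieldTheory.Balaban1983to89.B11Eq90StB
open Literature.MathematicalPhysics.QuantumFieldTheory.Balaban1983to89.B11Eq36Complex
open Literature.MathematicalPhysics.QuantumFieldTheory.Balaban1983to89.B11Eq90V0primeBond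
open Literature.MathematicalPhysics.QuantumFieldTheory.Balaban1983to89.B11Ineq189LocalLeaf
open Literature.Analysis.Complex.SCV Literature.Analysis.Complex.HolomorphicBanach

/-! ## §1 The two-variable Cauchy estimate through the (40) majorant (generic) -/

section Generic

variable {E : Type*} [NormedAddCommGroup E] [NormedSpace ℂ E] {F : Type*} [NormedAddCommGroup F] [NormedSpace ℂ F]
  [CompleteSpace F]

/-- **(63) ITERATED**: for an entire `Φ`, the mixed line derivative `(∂²∕∂z∂w)Φ(X + zu + wv)|_{z=w=0}` IS the second directional Fréchet
derivative `∂_u∂_v Φ(X)` (the inner line derivative is `DΦ(X + zu)·v` by (63); `Y ↦ DΦ(Y)·v` is again entire — directional derivatives of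
holomorphic maps are holomorphic — and (63) applies once more). [cite: Balaban1985Variational, (63) p.287, (185) p.308] -/
theorem deriv_deriv_line_eq_fderiv₂ {Φ : E → F} (hΦ : Differentiable ℂ Φ) (X u v : E) :
    deriv (fun z : ℂ => deriv (fun w : ℂ => Φ (X + z • u + w • v)) 0) 0
      = fderiv ℂ (fun Y => fderiv ℂ Φ Y v) X u := by
  have h1 : (fun z : ℂ => deriv (fun w : ℂ => Φ (X + z • u + w • v)) 0) = fun z => fderiv ℂ Φ (X + z • u) v := by
    funext z
    exact deriv_line_eq_fderiv (hΦ (X + z • u)) v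
  rw [h1]
  have hG : Differentiable ℂ (fun Y => fderiv ℂ Φ Y v) :=
    differentiableOn_univ.1 (differentiableOn_fderiv_apply hΦ.differentiableOn isOpen_univ v)
  exact deriv_line_eq_fderiv (hG X) u

/-- The same with the second Fréchet derivative: `(∂²∕∂z∂w)Φ(X + zu + wv)|₀ = D²Φ(X) u v`.
[cite: Balaban1985Variational, (63) p.287, (185) p.308] -/
theorem deriv_deriv_line_eq_fderiv_fderiv {Φ : E → F} (hΦ : Differentiable ℂ Φ) (X u v : E) :
    deriv (fun z : ℂ => deriv (fun w : ℂ => Φ (X + z • u + w • v)) 0) 0 = fderiv ℂ (fderiv ℂ Φ) X u v := by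
  rw [deriv_deriv_line_eq_fderiv₂ hΦ, fderiv_fderiv_apply hΦ.differentiableOn isOpen_univ (mem_univ X)]

omit [CompleteSpace F] in
/-- On the closed bidisc of radii `x∕(2Δ_u)`, `x∕(2Δ_v)` the linear size majorant `x + |z|Δ_u + |w|Δ_v` is at most `2x` (the «doubled
polydisc» of the census note). [folklore] [cite: Balaban1985Variational, p.291] -/
theorem plane_le_two {x Δu Δv : ℝ} (hΔu : 0 < Δu) (hΔv : 0 < Δv) {z w : ℂ}
    (hz : z ∈ closedBall (0 : ℂ) (x / (2 * Δu))) (hw : w ∈ closedBall (0 : ℂ) (x / (2 * Δv))) :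
    x + ‖z‖ * Δu + ‖w‖ * Δv ≤ 2 * x := by
  rw [mem_closedBall, dist_zero_right] at hz hw
  have h1 : ‖z‖ * Δu ≤ x / (2 * Δu) * Δu := mul_le_mul_of_nonneg_right hz hΔu.le
  have h2 : ‖w‖ * Δv ≤ x / (2 * Δv) * Δv := mul_le_mul_of_nonneg_right hw hΔv.le
  have e1 : x / (2 * Δu) * Δu = x / 2 := by
    rw [div_mul_eq_mul_div, mul_div_mul_right _ _ hΔu.ne']
  have e2 : x / (2 * Δv) * Δv = x / 2 := by
    rw [div_mul_eq_mul_div, mul_div_mul_right _ _ hΔv.ne']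
  linarith

/-- **TWO-VARIABLE CAUCHY THROUGH THE (40) MAJORANT** («the power of |A| lower by» two): an entire `Φ` (e.g.
`B ↦ V′₀(B, ∂p)`) with `‖Φ(X + zu + wv)‖ ≦ (x + |z|Δ_u + |w|Δ_v)³ηκ + (2∕4!)(x + |z|Δ_u + |w|Δ_v)⁴` on the closed bidisc
`|z| ≦ x∕(2Δ_u)`, `|w| ≦ x∕(2Δ_v)` (the first member of (40) along the plane, size `≦ 2x` there) has
`‖∂_u∂_v Φ(X)‖ ≦ Δ_uΔ_v(32·x·ηκ + (16∕3)x²)` — Cauchy's inequality in two variables with `M = (2x)³ηκ + (2∕4!)(2x)⁴`, `rr′ = x²∕(4Δ_uΔ_v)`.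
[cite: Balaban1985Variational, (90) p.291, (40) p.284, (185) p.308] -/
theorem norm_d2_le_of_majorant40 {Φ : E → F} (hΦ : Differentiable ℂ Φ) {X u v : E} {x Δu Δv η κ : ℝ}
    (hx : 0 < x) (hΔu : 0 < Δu) (hΔv : 0 < Δv) (hη : 0 ≤ η) (hκ : 0 ≤ κ)
    (h40 : ∀ z ∈ closedBall (0 : ℂ) (x / (2 * Δu)), ∀ w ∈ closedBall (0 : ℂ) (x / (2 * Δv)),
      ‖Φ (X + z • u + w • v)‖
        ≤ (x + ‖z‖ * Δu + ‖w‖ * Δv) ^ 3 * η * κ + 2 / 24 * (x + ‖z‖ * Δu + ‖w‖ * Δv) ^ 4) :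
    ‖fderiv ℂ (fun Y => fderiv ℂ Φ Y v) X u‖ ≤ Δu * Δv * (32 * x * η * κ + 16 / 3 * x ^ 2) := by
  have hr : 0 < x / (2 * Δu) := by positivity
  have hr' : 0 < x / (2 * Δv) := by positivity
  have hM : ∀ z ∈ closedBall (0 : ℂ) (x / (2 * Δu)), ∀ w ∈ closedBall (0 : ℂ) (x / (2 * Δv)),
      ‖Φ (X + z • u + w • v)‖ ≤ (2 * x) ^ 3 * η * κ + 2 / 24 * (2 * x) ^ 4 := by
    intro z hz w hw
    have hle : x + ‖z‖ * Δu + ‖w‖ * Δv ≤ 2 * x := plane_le_two hΔu hΔv hz hw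
    have h0 : 0 ≤ x + ‖z‖ * Δu + ‖w‖ * Δv := by positivity
    calc ‖Φ (X + z • u + w • v)‖
        ≤ (x + ‖z‖ * Δu + ‖w‖ * Δv) ^ 3 * η * κ + 2 / 24 * (x + ‖z‖ * Δu + ‖w‖ * Δv) ^ 4 := h40 z hz w hw
      _ ≤ (2 * x) ^ 3 * η * κ + 2 / 24 * (2 * x) ^ 4 := by gcongr
  have key := norm_fderiv_fderiv_apply_le_of_bound hΦ.differentiableOn isOpen_univ hr hr'
    (fun _ _ _ _ => mem_univ _) hM
  refine key.trans (le_of_eq ?_)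
  have hx0 : x ≠ 0 := hx.ne'
  have hΔu0 : Δu ≠ 0 := hΔu.ne'
  have hΔv0 : Δv ≠ 0 := hΔv.ne'
  field_simp
  ring

/-- The same for the second Fréchet derivative: `‖D²Φ(X) u v‖ ≦ Δ_uΔ_v(32·x·ηκ + (16∕3)x²)`.
[cite: Balaban1985Variational, (90) p.291, (40) p.284, (185) p.308] -/
theorem norm_fderiv_fderiv_le_of_majorant40 {Φ : E → F} (hΦ : Differentiable ℂ Φ) {X u v : E} {x Δu Δv η κ : ℝ}
    (hx : 0 < x) (hΔu : 0 < Δu) (hΔv : 0 < Δv) (hη : 0 ≤ η) (hκ : 0 ≤ κ)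
    (h40 : ∀ z ∈ closedBall (0 : ℂ) (x / (2 * Δu)), ∀ w ∈ closedBall (0 : ℂ) (x / (2 * Δv)),
      ‖Φ (X + z • u + w • v)‖
        ≤ (x + ‖z‖ * Δu + ‖w‖ * Δv) ^ 3 * η * κ + 2 / 24 * (x + ‖z‖ * Δu + ‖w‖ * Δv) ^ 4) :
    ‖fderiv ℂ (fderiv ℂ Φ) X u v‖ ≤ Δu * Δv * (32 * x * η * κ + 16 / 3 * x ^ 2) := by
  rw [fderiv_fderiv_apply hΦ.differentiableOn isOpen_univ (mem_univ X)]
  exact norm_d2_le_of_majorant40 hΦ hx hΔu hΔv hη hκ h40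

end Generic

/-! ## §2 p. 291's sentence iterated, for the genuine `V′₀(A, ∂p)` at complex configurations -/

variable {𝔸 : Type*} [NormedRing 𝔸] [NormedAlgebra ℂ 𝔸] [CompleteSpace 𝔸]
variable {S : Type*} [Fintype S] {ι : Type*} [Fintype ι] [LinearOrder ι]
variable (T : ι → Equiv.Perm S) (U : ι → S → 𝔸ˣ)

omit [CompleteSpace 𝔸] [Fintype S] [Fintype ι] [LinearOrder ι] in
/-- ALONG A COMPLEX PLANE the size grows at most linearly in each parameter:
`|A + zδ₁ + wδ₂|(∂p) ≦ |A|(∂p) + |z|·|δ₁|(∂p) + |w|·|δ₂|(∂p)` (`B11Eq90V0Derivative.size_lettersA_add_smul_le` twice).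
[cite: Balaban1985Variational, (25) p.282, (63) p.287] -/
theorem size_lettersA_add_smul_add_smul_le (A δ₁ δ₂ : ι → S → 𝔸) (z w : ℂ) (μ ν : ι) (x : S) :
    size (lettersA T U (A + z • δ₁ + w • δ₂) μ ν x)
      ≤ size (lettersA T U A μ ν x) + ‖z‖ * size (lettersA T U δ₁ μ ν x) + ‖w‖ * size (lettersA T U δ₂ μ ν x) := by
  have h1 := size_lettersA_add_smul_le T U (A + z • δ₁) δ₂ w μ ν x
  have h2 := size_lettersA_add_smul_le T U A δ₁ z μ ν x
  linarith

omit [LinearOrder ι] in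
/-- `V′₀(·, ∂p)` is entire (p. 282 «an analytic, and even an entire function of A»; `B11Eq90V0primeBond.contDiff_V0primeP`).
[cite: Balaban1985Variational, p.282, (39) p.284] -/
theorem differentiable_V0primeP (η : ℝ) (τ : 𝔸 →L[ℂ] ℂ) (μ ν : ι) (x : S) :
    Differentiable ℂ (fun B : ι → S → 𝔸 => V0primeP T U η (τ : 𝔸 →ₗ[ℂ] ℂ) B μ ν x) :=
  (contDiff_V0primeP T U (n := 1) η τ μ ν x).differentiable (by norm_num)

variable [StarRing 𝔸] [StarModule ℂ 𝔸]

omit [LinearOrder ι] in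
/-- **p. 291's SENTENCE ITERATED, FOR THE GENUINE `V′₀(A, ∂p)` AT COMPLEX `A`** («… a bound similar to the bound (40) for the function
V′₀(A, ∂p), but with the power of |A| lower by» TWO «and with a different absolute constant»): for `|A|(∂p) ≦ s`, `|δ₁|(∂p) ≦ Δ₁`,
`|δ₂|(∂p) ≦ Δ₂`, `0 < s, Δ₁, Δ₂`, `e^{2ηs} ≦ 2`, under the hypotheses of `B11Eq36Complex.ineq40_first_complex` (unitary background, tracial
`*`-trace, the (38)∕(31) trace slots with constant `κ`): `‖∂_{δ₁}∂_{δ₂}V′₀(A, ∂p)‖ ≦ Δ₁Δ₂(32·s·ηκ + (16∕3)s²)` — against the function's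
`s³ηκ + (2∕4!)s⁴` ((40)) and the first derivative's `Δ(8s²ηκ + (4∕3)s³)` (`B11Eq36Complex.norm_deriv_V0prime_line_le`): §1 with (40) at every
configuration of the bidisc (size `≦ s + |z|Δ₁ + |w|Δ₂ ≦ 2s`, so `e^{η·size} ≦ e^{2ηs} ≦ 2`).
[cite: Balaban1985Variational, (90) p.291, (40) p.284, (185) p.308, (189) p.308] -/
theorem norm_d2_V0primeP_le [NormOneClass 𝔸] (hU : ∀ μ x, (((U μ x)⁻¹ : 𝔸ˣ) : 𝔸) = star (U μ x : 𝔸))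
    (τ : 𝔸 →L[ℂ] ℂ) (hτ : ∀ a b : 𝔸, τ (a * b) = τ (b * a)) (hτs : ∀ a : 𝔸, τ (star a) = starRingEnd ℂ (τ a))
    {η : ℝ} (hη : 0 < η) {κ s Δ₁ Δ₂ : ℝ} (hκ : 0 ≤ κ) (A δ₁ δ₂ : ι → S → 𝔸) (μ ν : ι) (x : S)
    (hs : size (lettersA T U A μ ν x) ≤ s) (hΔ₁ : size (lettersA T U δ₁ μ ν x) ≤ Δ₁)
    (hΔ₂ : size (lettersA T U δ₂ μ ν x) ≤ Δ₂) (hs0 : 0 < s) (hΔ₁0 : 0 < Δ₁) (hΔ₂0 : 0 < Δ₂)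
    (hexp : Real.exp (2 * η * s) ≤ 2)
    (hRe1 : ∀ Z : 𝔸, ‖(τ : 𝔸 →ₗ[ℂ] ℂ) (Z * (reC (plaqU T U μ ν x) - 1))‖ ≤ ‖Z‖ * (η ^ 2 * κ))
    (hIm : ∀ Z : 𝔸, ‖(τ : 𝔸 →ₗ[ℂ] ℂ) (Z * (((η : ℂ) ^ 2)⁻¹ • imC (plaqU T U μ ν x)))‖ ≤ ‖Z‖ * κ)
    (hW : ∀ Z : 𝔸, ‖(τ : 𝔸 →ₗ[ℂ] ℂ) (Z * (plaqU T U μ ν x : 𝔸))‖ ≤ ‖Z‖)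
    (hW' : ∀ Z : 𝔸, ‖(τ : 𝔸 →ₗ[ℂ] ℂ) (Z * (((plaqU T U μ ν x)⁻¹ : 𝔸ˣ) : 𝔸))‖ ≤ ‖Z‖) :
    ‖fderiv ℂ (fun Y => fderiv ℂ (fun B : ι → S → 𝔸 => V0primeP T U η (τ : 𝔸 →ₗ[ℂ] ℂ) B μ ν x) Y δ₂) A δ₁‖
      ≤ Δ₁ * Δ₂ * (32 * s * η * κ + 16 / 3 * s ^ 2) := by
  refine norm_d2_le_of_majorant40 (differentiable_V0primeP T U η τ μ ν x) hs0 hΔ₁0 hΔ₂0 hη.le hκ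
    fun z hz w hw => ?_
  -- on the bidisc the size of the letters is `≤ s + |z|Δ₁ + |w|Δ₂ ≤ 2s`
  have hst : size (lettersA T U (A + z • δ₁ + w • δ₂) μ ν x) ≤ s + ‖z‖ * Δ₁ + ‖w‖ * Δ₂ :=
    (size_lettersA_add_smul_add_smul_le T U A δ₁ δ₂ z w μ ν x).trans (by gcongr)
  have h2s : s + ‖z‖ * Δ₁ + ‖w‖ * Δ₂ ≤ 2 * s := plane_le_two hΔ₁0 hΔ₂0 hz hw
  have hexp' : Real.exp (η * (s + ‖z‖ * Δ₁ + ‖w‖ * Δ₂)) ≤ 2 := by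
    refine le_trans (Real.exp_le_exp.2 ?_) hexp
    calc η * (s + ‖z‖ * Δ₁ + ‖w‖ * Δ₂) ≤ η * (2 * s) := mul_le_mul_of_nonneg_left h2s hη.le
      _ = 2 * η * s := by ring
  show ‖V0primeP T U η (τ : 𝔸 →ₗ[ℂ] ℂ) (A + z • δ₁ + w • δ₂) μ ν x‖ ≤ _
  rw [V0primeP_eq]
  exact ineq40_first_complex T U hU τ hτ hτs hη hκ (A + z • δ₁ + w • δ₂) μ ν x hst hexp' hRe1 hIm hW hW'

omit [LinearOrder ι] in
/-- **THE SENTENCE ITERATED, LINE FORM**: the iterated line derivative `(∂²∕∂z∂w)V′₀(A + zδ₁ + wδ₂, ∂p)|_{z=w=0}` ((63)∕(185) twice)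
obeys the same bound `Δ₁Δ₂(32·s·ηκ + (16∕3)s²)`. [cite: Balaban1985Variational, (90) p.291, (63) p.287, (185) p.308] -/
theorem norm_deriv_deriv_V0primeP_line_le [NormOneClass 𝔸] (hU : ∀ μ x, (((U μ x)⁻¹ : 𝔸ˣ) : 𝔸) = star (U μ x : 𝔸))
    (τ : 𝔸 →L[ℂ] ℂ) (hτ : ∀ a b : 𝔸, τ (a * b) = τ (b * a)) (hτs : ∀ a : 𝔸, τ (star a) = starRingEnd ℂ (τ a))
    {η : ℝ} (hη : 0 < η) {κ s Δ₁ Δ₂ : ℝ} (hκ : 0 ≤ κ) (A δ₁ δ₂ : ι → S → 𝔸) (μ ν : ι) (x : S)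
    (hs : size (lettersA T U A μ ν x) ≤ s) (hΔ₁ : size (lettersA T U δ₁ μ ν x) ≤ Δ₁)
    (hΔ₂ : size (lettersA T U δ₂ μ ν x) ≤ Δ₂) (hs0 : 0 < s) (hΔ₁0 : 0 < Δ₁) (hΔ₂0 : 0 < Δ₂)
    (hexp : Real.exp (2 * η * s) ≤ 2)
    (hRe1 : ∀ Z : 𝔸, ‖(τ : 𝔸 →ₗ[ℂ] ℂ) (Z * (reC (plaqU T U μ ν x) - 1))‖ ≤ ‖Z‖ * (η ^ 2 * κ))
    (hIm : ∀ Z : 𝔸, ‖(τ : 𝔸 →ₗ[ℂ] ℂ) (Z * (((η : ℂ) ^ 2)⁻¹ • imC (plaqU T U μ ν x)))‖ ≤ ‖Z‖ * κ)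
    (hW : ∀ Z : 𝔸, ‖(τ : 𝔸 →ₗ[ℂ] ℂ) (Z * (plaqU T U μ ν x : 𝔸))‖ ≤ ‖Z‖)
    (hW' : ∀ Z : 𝔸, ‖(τ : 𝔸 →ₗ[ℂ] ℂ) (Z * (((plaqU T U μ ν x)⁻¹ : 𝔸ˣ) : 𝔸))‖ ≤ ‖Z‖) :
    ‖deriv (fun z : ℂ => deriv (fun w : ℂ =>
        V0primeP T U η (τ : 𝔸 →ₗ[ℂ] ℂ) (A + z • δ₁ + w • δ₂) μ ν x) 0) 0‖
      ≤ Δ₁ * Δ₂ * (32 * s * η * κ + 16 / 3 * s ^ 2) := by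
  have e : deriv (fun z : ℂ => deriv (fun w : ℂ =>
        V0primeP T U η (τ : 𝔸 →ₗ[ℂ] ℂ) (A + z • δ₁ + w • δ₂) μ ν x) 0) 0
      = fderiv ℂ (fun Y => fderiv ℂ (fun B : ι → S → 𝔸 => V0primeP T U η (τ : 𝔸 →ₗ[ℂ] ℂ) B μ ν x) Y δ₂) A δ₁ :=
    deriv_deriv_line_eq_fderiv₂ (differentiable_V0primeP T U η τ μ ν x) A δ₁ δ₂
  rw [e]
  exact norm_d2_V0primeP_le T U hU τ hτ hτs hη hκ A δ₁ δ₂ μ ν x hs hΔ₁ hΔ₂ hs0 hΔ₁0 hΔ₂0 hexp hRe1 hIm hW hW'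

omit [LinearOrder ι] in
/-- **THE SENTENCE ITERATED, FRÉCHET FORM**: `‖D²V′₀(A, ∂p) δ₁ δ₂‖ ≦ Δ₁Δ₂(32·s·ηκ + (16∕3)s²)` (the second Fréchet derivative evaluated,
`D²Φ(A) δ₁ δ₂ = ∂_{δ₁}∂_{δ₂}Φ(A)`). [cite: Balaban1985Variational, (90) p.291, (185) p.308, (189) p.308] -/
theorem norm_fderiv_fderiv_V0primeP_le [NormOneClass 𝔸] (hU : ∀ μ x, (((U μ x)⁻¹ : 𝔸ˣ) : 𝔸) = star (U μ x : 𝔸))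
    (τ : 𝔸 →L[ℂ] ℂ) (hτ : ∀ a b : 𝔸, τ (a * b) = τ (b * a)) (hτs : ∀ a : 𝔸, τ (star a) = starRingEnd ℂ (τ a))
    {η : ℝ} (hη : 0 < η) {κ s Δ₁ Δ₂ : ℝ} (hκ : 0 ≤ κ) (A δ₁ δ₂ : ι → S → 𝔸) (μ ν : ι) (x : S)
    (hs : size (lettersA T U A μ ν x) ≤ s) (hΔ₁ : size (lettersA T U δ₁ μ ν x) ≤ Δ₁)
    (hΔ₂ : size (lettersA T U δ₂ μ ν x) ≤ Δ₂) (hs0 : 0 < s) (hΔ₁0 : 0 < Δ₁) (hΔ₂0 : 0 < Δ₂)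
    (hexp : Real.exp (2 * η * s) ≤ 2)
    (hRe1 : ∀ Z : 𝔸, ‖(τ : 𝔸 →ₗ[ℂ] ℂ) (Z * (reC (plaqU T U μ ν x) - 1))‖ ≤ ‖Z‖ * (η ^ 2 * κ))
    (hIm : ∀ Z : 𝔸, ‖(τ : 𝔸 →ₗ[ℂ] ℂ) (Z * (((η : ℂ) ^ 2)⁻¹ • imC (plaqU T U μ ν x)))‖ ≤ ‖Z‖ * κ)
    (hW : ∀ Z : 𝔸, ‖(τ : 𝔸 →ₗ[ℂ] ℂ) (Z * (plaqU T U μ ν x : 𝔸))‖ ≤ ‖Z‖)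
    (hW' : ∀ Z : 𝔸, ‖(τ : 𝔸 →ₗ[ℂ] ℂ) (Z * (((plaqU T U μ ν x)⁻¹ : 𝔸ˣ) : 𝔸))‖ ≤ ‖Z‖) :
    ‖fderiv ℂ (fderiv ℂ (fun B : ι → S → 𝔸 => V0primeP T U η (τ : 𝔸 →ₗ[ℂ] ℂ) B μ ν x)) A δ₁ δ₂‖
      ≤ Δ₁ * Δ₂ * (32 * s * η * κ + 16 / 3 * s ^ 2) := by
  rw [fderiv_fderiv_apply (differentiable_V0primeP T U η τ μ ν x).differentiableOn isOpen_univ (mem_univ A)]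
  exact norm_d2_V0primeP_le T U hU τ hτ hτs hη hκ A δ₁ δ₂ μ ν x hs hΔ₁ hΔ₂ hs0 hΔ₁0 hΔ₂0 hexp hRe1 hIm hW hW'

/-! ## §3 The two-bond kernel entries `(∂²∕∂A(b₁)∂A(b₂))V′₀(A, ∂q)`: locality and the bound -/

section Bond

variable [DecidableEq S]

omit [StarRing 𝔸] [StarModule ℂ 𝔸] in
/-- **LOCALITY, inner slot**: a positively oriented plaquette `q ∉ st(b)` does not see the bond `b = (μ₀, x₀)` —
`∂_{δ_b Y}V′₀(B, ∂q) = 0` at EVERY configuration `B` (its boundary letters are blind to `δ_b Y`,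
`B11Eq90StB.lettersA_bondDelta_of_not_mem_st`; the line `t ↦ V′₀(B + tδ_b Y, ∂q)` is constant). [cite: Balaban1985Variational, (90) p.291] -/
theorem fderiv_V0primeP_bondDelta_eq_zero (η : ℝ) (τ : 𝔸 →L[ℂ] ℂ) {q : S × ι × ι} (hq : q ∈ posPlaq S ι)
    {μ₀ : ι} {x₀ : S} (hst : q ∉ st T μ₀ x₀) (B : ι → S → 𝔸) (Y : 𝔸) :
    fderiv ℂ (fun B' : ι → S → 𝔸 => V0primeP T U η (τ : 𝔸 →ₗ[ℂ] ℂ) B' q.2.1 q.2.2 q.1) B (bondDelta μ₀ x₀ Y) = 0 := by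
  rw [← deriv_line_eq_fderiv ((differentiable_V0primeP T U η τ q.2.1 q.2.2 q.1) B)]
  have hδ := lettersA_bondDelta_of_not_mem_st T U μ₀ x₀ Y q hq hst
  simp only [V0primeP_add_smul_of_letters_zero T U η (τ : 𝔸 →ₗ[ℂ] ℂ) hδ, deriv_const]

omit [StarRing 𝔸] [StarModule ℂ 𝔸] in
/-- **LOCALITY OF THE TWO-BOND ENTRY, inner slot**: if `q ∉ st(b₂)` then `∂_u∂_{δ_{b₂}Y}V′₀(A, ∂q) = 0` for every direction `u`.
[cite: Balaban1985Variational, (90) p.291, (189) p.308] -/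
theorem d2_V0primeP_bond_eq_zero_right (η : ℝ) (τ : 𝔸 →L[ℂ] ℂ) {q : S × ι × ι} (hq : q ∈ posPlaq S ι)
    {μ₂ : ι} {x₂ : S} (hst : q ∉ st T μ₂ x₂) (A u : ι → S → 𝔸) (Y : 𝔸) :
    fderiv ℂ (fun B' => fderiv ℂ (fun B : ι → S → 𝔸 => V0primeP T U η (τ : 𝔸 →ₗ[ℂ] ℂ) B q.2.1 q.2.2 q.1) B'
      (bondDelta μ₂ x₂ Y)) A u = 0 := by
  have h : (fun B' => fderiv ℂ (fun B : ι → S → 𝔸 => V0primeP T U η (τ : 𝔸 →ₗ[ℂ] ℂ) B q.2.1 q.2.2 q.1) B'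
      (bondDelta μ₂ x₂ Y)) = fun _ => (0 : ℂ) :=
    funext fun B' => fderiv_V0primeP_bondDelta_eq_zero T U η τ hq hst B' Y
  rw [h]
  simp

omit [StarRing 𝔸] [StarModule ℂ 𝔸] in
/-- **LOCALITY OF THE TWO-BOND ENTRY, outer slot**: if `q ∉ st(b₁)` then `∂_{δ_{b₁}X}∂_v V′₀(A, ∂q) = 0` for every direction `v`
(the inner derivative `B ↦ ∂_v V′₀(B, ∂q)` is invariant under `B ↦ B + tδ_{b₁}X`). [cite: Balaban1985Variational, (90) p.291, (189) p.308] -/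
theorem d2_V0primeP_bond_eq_zero_left (η : ℝ) (τ : 𝔸 →L[ℂ] ℂ) {q : S × ι × ι} (hq : q ∈ posPlaq S ι)
    {μ₁ : ι} {x₁ : S} (hst : q ∉ st T μ₁ x₁) (A v : ι → S → 𝔸) (X : 𝔸) :
    fderiv ℂ (fun B' => fderiv ℂ (fun B : ι → S → 𝔸 => V0primeP T U η (τ : 𝔸 →ₗ[ℂ] ℂ) B q.2.1 q.2.2 q.1) B' v)
      A (bondDelta μ₁ x₁ X) = 0 := by
  set Φ : (ι → S → 𝔸) → ℂ := fun B => V0primeP T U η (τ : 𝔸 →ₗ[ℂ] ℂ) B q.2.1 q.2.2 q.1 with hΦdef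
  have hΦ : Differentiable ℂ Φ := differentiable_V0primeP T U η τ q.2.1 q.2.2 q.1
  have hG : Differentiable ℂ (fun Y => fderiv ℂ Φ Y v) :=
    differentiableOn_univ.1 (differentiableOn_fderiv_apply hΦ.differentiableOn isOpen_univ v)
  rw [← deriv_line_eq_fderiv (hG A)]
  have hδ := lettersA_bondDelta_of_not_mem_st T U μ₁ x₁ X q hq hst
  have hinv : ∀ t : ℂ, fderiv ℂ Φ (A + t • bondDelta μ₁ x₁ X) v = fderiv ℂ Φ A v := by
    intro t
    rw [← deriv_line_eq_fderiv (hΦ _), ← deriv_line_eq_fderiv (hΦ _)]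
    congr 1
    funext w
    rw [add_right_comm A (t • bondDelta μ₁ x₁ X) (w • v)]
    exact V0primeP_add_smul_of_letters_zero T U η (τ : 𝔸 →ₗ[ℂ] ℂ) hδ t
  simp only [hinv, deriv_const]

omit [NormedAlgebra ℂ 𝔸] [CompleteSpace 𝔸] [Fintype S] [Fintype ι] [StarRing 𝔸] [StarModule ℂ 𝔸] in
/-- The one-bond variation of the zero matrix is the zero configuration. [folklore] [cite: Balaban1985Variational, (90) p.291] -/
theorem bondDelta_zero (μ₀ : ι) (x₀ : S) : bondDelta (S := S) μ₀ x₀ (0 : 𝔸) = 0 := by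
  funext κ y
  simp [bondDelta]

/-- **THE TWO-BOND ENTRY BOUND** — `‖∂_{δ_{b₁}X}∂_{δ_{b₂}Y}V′₀(A, ∂q)‖ ≦ 16(32·s·ηκ + (16∕3)s²)‖X‖‖Y‖` for `|A|(∂q) ≦ s`, `0 < s`,
`e^{2ηs} ≦ 2`, under the hypotheses of `B11Eq90V0primeBond.opNorm_dV0primeBond_le` (unitary background in the unit balls, tracial `*`-trace,
the (38)∕(31) trace slots with constant `κ`): `norm_d2_V0primeP_le` at `δᵢ = δ_{bᵢ}(·)`, `Δ₁ = 4‖X‖`, `Δ₂ = 4‖Y‖`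
(`|δ_b X|(∂q) ≦ 4‖X‖`). [cite: Balaban1985Variational, (90) p.291, (40) p.284, (189) p.308] -/
theorem norm_d2_V0primeP_bond_le [NormOneClass 𝔸] (hU : ∀ μ x, (((U μ x)⁻¹ : 𝔸ˣ) : 𝔸) = star (U μ x : 𝔸))
    (hUn : ∀ μ x, ‖(U μ x : 𝔸)‖ ≤ 1 ∧ ‖(((U μ x)⁻¹ : 𝔸ˣ) : 𝔸)‖ ≤ 1)
    (τ : 𝔸 →L[ℂ] ℂ) (hτ : ∀ a b : 𝔸, τ (a * b) = τ (b * a)) (hτs : ∀ a : 𝔸, τ (star a) = starRingEnd ℂ (τ a))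
    {η : ℝ} (hη : 0 < η) {κ s : ℝ} (hκ : 0 ≤ κ) (A : ι → S → 𝔸) (q : S × ι × ι) (μ₁ : ι) (x₁ : S) (μ₂ : ι) (x₂ : S)
    (X Y : 𝔸) (hs : size (lettersA T U A q.2.1 q.2.2 q.1) ≤ s) (hs0 : 0 < s) (hexp : Real.exp (2 * η * s) ≤ 2)
    (hRe1 : ∀ Z : 𝔸, ‖(τ : 𝔸 →ₗ[ℂ] ℂ) (Z * (reC (plaqU T U q.2.1 q.2.2 q.1) - 1))‖ ≤ ‖Z‖ * (η ^ 2 * κ))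
    (hIm : ∀ Z : 𝔸, ‖(τ : 𝔸 →ₗ[ℂ] ℂ) (Z * (((η : ℂ) ^ 2)⁻¹ • imC (plaqU T U q.2.1 q.2.2 q.1)))‖ ≤ ‖Z‖ * κ)
    (hW : ∀ Z : 𝔸, ‖(τ : 𝔸 →ₗ[ℂ] ℂ) (Z * (plaqU T U q.2.1 q.2.2 q.1 : 𝔸))‖ ≤ ‖Z‖)
    (hW' : ∀ Z : 𝔸, ‖(τ : 𝔸 →ₗ[ℂ] ℂ) (Z * (((plaqU T U q.2.1 q.2.2 q.1)⁻¹ : 𝔸ˣ) : 𝔸))‖ ≤ ‖Z‖) :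
    ‖fderiv ℂ (fun B' => fderiv ℂ (fun B : ι → S → 𝔸 => V0primeP T U η (τ : 𝔸 →ₗ[ℂ] ℂ) B q.2.1 q.2.2 q.1) B'
        (bondDelta μ₂ x₂ Y)) A (bondDelta μ₁ x₁ X)‖
      ≤ 16 * (32 * s * η * κ + 16 / 3 * s ^ 2) * ‖X‖ * ‖Y‖ := by
  by_cases hX : X = 0
  · subst hX
    simp [bondDelta_zero]
  by_cases hY : Y = 0
  · subst hY
    simp [bondDelta_zero]
  have hΔ₁ : 0 < 4 * ‖X‖ := by positivity
  have hΔ₂ : 0 < 4 * ‖Y‖ := by positivity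
  have h := norm_d2_V0primeP_le T U hU τ hτ hτs hη hκ A (bondDelta μ₁ x₁ X) (bondDelta μ₂ x₂ Y) q.2.1 q.2.2 q.1
    hs (size_lettersA_bondDelta_le T U hUn μ₁ x₁ X q.2.1 q.2.2 q.1)
    (size_lettersA_bondDelta_le T U hUn μ₂ x₂ Y q.2.1 q.2.2 q.1) hs0 hΔ₁ hΔ₂ hexp hRe1 hIm hW hW'
  calc _ ≤ 4 * ‖X‖ * (4 * ‖Y‖) * (32 * s * η * κ + 16 / 3 * s ^ 2) := h
    _ = 16 * (32 * s * η * κ + 16 / 3 * s ^ 2) * ‖X‖ * ‖Y‖ := by ring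

end Bond

/-! ## §4 The (189) junction scalars: «O(1)(|A|ηκ + |A|²)» in the letters of (38)∕(57) -/

/-- **THE (189)-T4 JUNCTION, first step** (companion of `B11Eq90V0Derivative.hg90_of_deriv40`): the second-derivative majorant
`g ≦ Δ(32sη·K∕t² + (16∕3)s²)` with `|A|(∂p) ≦ s ≦ 4x` (`x` = the sup majorant of `|A|`), `κ = K(Lʲη)⁻²` (`K = C₁B₃ε₁`, (38)), `η ≦ Lʲη = t`
gives `g ≦ 128Δ·x(K + tx)∕t` — the first-derivative junction `128Δ·x²(K + tx)∕t` with ONE MORE power of `x` removed.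
[cite: Balaban1985Variational, (90) p.291, (40) p.284, (189) p.308] -/
theorem hβ189_of_d2_40 {g s Δ η K t x : ℝ} (hg : g ≤ Δ * (32 * s * η * (K / t ^ 2) + 16 / 3 * s ^ 2))
    (hΔ : 0 ≤ Δ) (hs0 : 0 ≤ s) (hsx : s ≤ 4 * x) (hK : 0 ≤ K) (ht : 0 < t) (hη0 : 0 ≤ η) (hηt : η ≤ t) :
    g ≤ 128 * Δ * x * (K + t * x) / t := by
  have hx0 : 0 ≤ x := by linarith
  have hs2 : s ^ 2 ≤ 16 * x ^ 2 := by nlinarith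
  have hηt2 : η / t ^ 2 ≤ 1 / t := by
    rw [div_le_div_iff₀ (by positivity) ht]
    nlinarith
  have h1 : 32 * s * η * (K / t ^ 2) ≤ 128 * x * K / t := by
    calc 32 * s * η * (K / t ^ 2) = 32 * s * K * (η / t ^ 2) := by ring
      _ ≤ 32 * (4 * x) * K * (1 / t) := by gcongr
      _ = 128 * x * K / t := by ring
  have h2 : 16 / 3 * s ^ 2 ≤ 128 * x * (t * x) / t := by
    have e : 128 * x * (t * x) / t = 128 * x ^ 2 := by
      field_simp
    rw [e]
    nlinarith
  calc g ≤ Δ * (32 * s * η * (K / t ^ 2) + 16 / 3 * s ^ 2) := hg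
    _ ≤ Δ * (128 * x * K / t + 128 * x * (t * x) / t) := mul_le_mul_of_nonneg_left (add_le_add h1 h2) hΔ
    _ = 128 * Δ * x * (K + t * x) / t := by ring

/-- **THE (189)-T4 JUNCTION** (companion of `B11Eq85FirstDerivative.ineq90`): with `K = C₁B₃ε₁` and `Lʲη·x ≦ 2ε₃` ((57)) the
second-derivative majorant is `g ≦ 512Δ·max{C₁B₃, 1}·ε₃(ε₁ + ε₃)(Lʲη)⁻²` — the census's «β = O(1)ε₃(ε₁ + ε₃)» for T4.1″ (`Δ = Δ₁Δ₂` carries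
the two direction sizes and their scale weights). [cite: Balaban1985Variational, (90) p.291, (189) p.308] -/
theorem ineq189_T41_of_d2_40 {g s Δ η C₁B₃ ε₁ ε₃ t x : ℝ}
    (hg : g ≤ Δ * (32 * s * η * (C₁B₃ * ε₁ / t ^ 2) + 16 / 3 * s ^ 2))
    (hΔ : 0 ≤ Δ) (hs0 : 0 ≤ s) (hsx : s ≤ 4 * x) (hC : 0 ≤ C₁B₃) (hε₁ : 0 ≤ ε₁) (ht : 0 < t) (hη0 : 0 ≤ η)
    (hηt : η ≤ t) (hx0 : 0 ≤ x) (hx : t * x ≤ 2 * ε₃) :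
    g ≤ 512 * Δ * max C₁B₃ 1 * ε₃ * (ε₁ + ε₃) / t ^ 2 := by
  have h1 := hβ189_of_d2_40 hg hΔ hs0 hsx (mul_nonneg hC hε₁) ht hη0 hηt
  have hε₃ : 0 ≤ ε₃ := by nlinarith [mul_nonneg ht.le hx0]
  have hM1 : (1 : ℝ) ≤ max C₁B₃ 1 := le_max_right _ _
  have hMC : C₁B₃ ≤ max C₁B₃ 1 := le_max_left _ _
  have hxle : x ≤ 2 * ε₃ / t := by
    rw [le_div_iff₀ ht]
    linarith [mul_comm t x]
  have hfac : C₁B₃ * ε₁ + t * x ≤ 2 * max C₁B₃ 1 * (ε₁ + ε₃) := by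
    have a1 : C₁B₃ * ε₁ ≤ max C₁B₃ 1 * ε₁ := mul_le_mul_of_nonneg_right hMC hε₁
    have a2 : 1 * ε₃ ≤ max C₁B₃ 1 * ε₃ := mul_le_mul_of_nonneg_right hM1 hε₃
    have a3 : 1 * ε₁ ≤ max C₁B₃ 1 * ε₁ := mul_le_mul_of_nonneg_right hM1 hε₁
    linarith
  have hfac0 : 0 ≤ C₁B₃ * ε₁ + t * x := by positivity
  calc g ≤ 128 * Δ * x * (C₁B₃ * ε₁ + t * x) / t := h1
    _ ≤ 128 * Δ * (2 * ε₃ / t) * (2 * max C₁B₃ 1 * (ε₁ + ε₃)) / t := by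
        gcongr
    _ = 512 * Δ * max C₁B₃ 1 * ε₃ * (ε₁ + ε₃) / t ^ 2 := by
        field_simp
        ring

/-! ## §5 End to end: the census's T4.1″ leaf for the genuine `V′₀`, from print's data -/

section EndToEnd

variable [DecidableEq S]

/-- **THE (189) LEAF T4.1″ FOR THE GENUINE TWO-BOND ENTRIES, END TO END** — `norm_d2_V0primeP_bond_le` fed BY NAME into
`ineq189_T41_of_d2_40` at `κ = C₁B₃ε₁(Lʲη)⁻²` ((38)): with `|A|(∂q) ≦ s ≦ 4x`, `Lʲη·x ≦ 2ε₃` ((57)), `η ≦ Lʲη = t`, `e^{2ηs} ≦ 2`: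
`‖∂_{δ_{b₁}X}∂_{δ_{b₂}Y}V′₀(A, ∂q)‖ ≦ 512·(16‖X‖‖Y‖)·max{C₁B₃, 1}·ε₃(ε₁ + ε₃)(Lʲη)⁻²` — «O(1)(|A|ηC₁B₃ε₁(Lʲη)⁻² + |A|²)|u||v|» of the census
leaf U2(ii) read on Ω_j, i.e. the T4.1″ size «O(1)ε₃(ε₁ + ε₃)» per unit directions. [cite: Balaban1985Variational, (90) p.291, (189) p.308] -/
theorem ineq189_leafT41_V0prime [NormOneClass 𝔸] (hU : ∀ μ x, (((U μ x)⁻¹ : 𝔸ˣ) : 𝔸) = star (U μ x : 𝔸))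
    (hUn : ∀ μ x, ‖(U μ x : 𝔸)‖ ≤ 1 ∧ ‖(((U μ x)⁻¹ : 𝔸ˣ) : 𝔸)‖ ≤ 1)
    (τ : 𝔸 →L[ℂ] ℂ) (hτ : ∀ a b : 𝔸, τ (a * b) = τ (b * a)) (hτs : ∀ a : 𝔸, τ (star a) = starRingEnd ℂ (τ a))
    {η : ℝ} (hη : 0 < η) {s C₁B₃ ε₁ t : ℝ} (hC : 0 ≤ C₁B₃) (hε₁ : 0 ≤ ε₁) (ht : 0 < t)
    (A : ι → S → 𝔸) (q : S × ι × ι) (μ₁ : ι) (x₁ : S) (μ₂ : ι) (x₂ : S) (X Y : 𝔸)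
    (hs : size (lettersA T U A q.2.1 q.2.2 q.1) ≤ s) (hs0 : 0 < s) (hexp : Real.exp (2 * η * s) ≤ 2)
    (hRe1 : ∀ Z : 𝔸, ‖(τ : 𝔸 →ₗ[ℂ] ℂ) (Z * (reC (plaqU T U q.2.1 q.2.2 q.1) - 1))‖
      ≤ ‖Z‖ * (η ^ 2 * (C₁B₃ * ε₁ / t ^ 2)))
    (hIm : ∀ Z : 𝔸, ‖(τ : 𝔸 →ₗ[ℂ] ℂ) (Z * (((η : ℂ) ^ 2)⁻¹ • imC (plaqU T U q.2.1 q.2.2 q.1)))‖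
      ≤ ‖Z‖ * (C₁B₃ * ε₁ / t ^ 2))
    (hW : ∀ Z : 𝔸, ‖(τ : 𝔸 →ₗ[ℂ] ℂ) (Z * (plaqU T U q.2.1 q.2.2 q.1 : 𝔸))‖ ≤ ‖Z‖)
    (hW' : ∀ Z : 𝔸, ‖(τ : 𝔸 →ₗ[ℂ] ℂ) (Z * (((plaqU T U q.2.1 q.2.2 q.1)⁻¹ : 𝔸ˣ) : 𝔸))‖ ≤ ‖Z‖)
    {xA ε₃ : ℝ} (hx0 : 0 ≤ xA) (hx : t * xA ≤ 2 * ε₃) (hsx : s ≤ 4 * xA) (hηt : η ≤ t) :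
    ‖fderiv ℂ (fun B' => fderiv ℂ (fun B : ι → S → 𝔸 => V0primeP T U η (τ : 𝔸 →ₗ[ℂ] ℂ) B q.2.1 q.2.2 q.1) B'
        (bondDelta μ₂ x₂ Y)) A (bondDelta μ₁ x₁ X)‖
      ≤ 512 * (16 * ‖X‖ * ‖Y‖) * max C₁B₃ 1 * ε₃ * (ε₁ + ε₃) / t ^ 2 := by
  have h := norm_d2_V0primeP_bond_le T U hU hUn τ hτ hτs hη (by positivity : 0 ≤ C₁B₃ * ε₁ / t ^ 2) A q μ₁ x₁ μ₂ x₂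
    X Y hs hs0 hexp hRe1 hIm hW hW'
  have h' : ‖fderiv ℂ (fun B' => fderiv ℂ (fun B : ι → S → 𝔸 => V0primeP T U η (τ : 𝔸 →ₗ[ℂ] ℂ) B q.2.1 q.2.2 q.1) B'
        (bondDelta μ₂ x₂ Y)) A (bondDelta μ₁ x₁ X)‖
      ≤ 16 * ‖X‖ * ‖Y‖ * (32 * s * η * (C₁B₃ * ε₁ / t ^ 2) + 16 / 3 * s ^ 2) :=
    h.trans (le_of_eq (by ring))
  exact ineq189_T41_of_d2_40 h' (by positivity) hs0.le hsx hC hε₁ ht hη.le hηt hx0 hx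

end EndToEnd

end Literature.MathematicalPhysics.QuantumFieldTheory.Balaban1983to89.B11Eq90V0primeSecondDerivative
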